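import Summits.BirchSwinnertonDyer.BirchSwinnertonDyer.Theorems.Rank1ResidualJetSelmerDefs
import Mathlib.GroupTheory.Perm.Cycle.Type
import HarnessLib

/-!
# T1 JET (cell `bsd-jet`), road K: Jetchev's (δ) — the LOCAL INDEX `[H¹_Kum(K_v) : H¹_{Kum⁰}(K_v)]`
# at level `p^k` is EXACTLY `p^{ord_p c_v}` once `k ≥ ord_p c_v` (no cyclicity needed) — the S3
# input of the duality package `hdual_q` of `JET.tamagawaExponent_le_mInfty_of_kernelInputs`

HONEST FRAMING (programme file §HONESTY, verbatim): «no tranche here proves BSD; ARM L moves the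
LITERAL column of an r ≤ 1 census into the kernel-proved-modulo-named-print column.» THEOREMS ONLY
(seat `bsd-jet-pv-2`, session g3; `--supports stmt-BirchSwinnertonDyer-14418`, helper); 0 classes
move. WHAT THIS IS. [J] p. 822 (δ) / Lemma 3.2 (p. 814): at a place `v` of bad reduction,
`H¹_Kum(K_v, E[p^m]) / H¹_{Kum⁰}(K_v, E[p^m]) ≅ ℤ/p^{m_v}`, `m_v = ord_p c_v`, for `m > m_v`. x11b3's
`JetchevKummer.relIndex_connectedKummerCondition` gives `[𝓛 : Kum⁰] = [E(K_v) : E₀ + n·E(K_v)]` and the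
O6 file `WildThreeJetchevClosure` the case `c_v ∣ n` (`= c_v`). Here the GENERAL index: for a subgroup
`H ≤ A` of finite index `c` and `n = p^k` with `k ≥ ord_p c`, `[A : H + p^k A] = p^{ord_p c}` — pure group
theory (Cauchy's theorem on the two quotients `A/(H + p^k A)` (killed by `p^k`, so a `p`-group) and
`(H + p^k A)/H` (killed by the prime-to-`p` part of `c`), and `[A : H] = [A : M]·[M : H]`), with NO
cyclicity hypothesis on `A/H`; hence `[𝓛_{K_v} : H¹_{Kum⁰}(K_v, E[p^k])] = p^{ord_p c_v}` for `k ≥ ord_p c_v`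
(`relIndex_connectedKummerCondition_eq_pow`), and the same for the tree's stringent family
`JET.stringentFamily` at a minimal place (`relIndex_stringentFamily_eq_pow`). (The cyclicity of the
quotient, also asserted in (δ), is a statement about the component group `Φ_v(k_v)` and is not treated
here.) References: [cite: Jetchev2008, Lemma 3.2 (p. 814), proof of Thm. 5.2 (p. 822, (δ))]
[cite: SilvermanAEC2009, VII.6 (c_v = [E(K_v) : E₀(K_v)])].
-/

set_option autoImplicit false

noncomputable section

open scoped Classical

open WeierstrassCurve IsDedekindDomain NumberField Literature.NumberTheory.EllipticCurves
  Literature.NumberTheory.GaloisRepresentations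
  Literature.NumberTheory.GaloisRepresentations.DiscreteGaloisModule
  Summit.BirchSwinnertonDyer.Rank1Residual.X11b.Three

namespace Summit.BirchSwinnertonDyer.Rank1Residual.JET

/-! ## §1 Group theory: `[A : H + p^k A] = p^{ord_p [A : H]}` for `k ≥ ord_p [A : H]` -/

section GroupTheory

variable {A : Type*} [AddCommGroup A]

/-- **Cauchy on a finite quotient**: if a subgroup `M` of finite index contains `m • a` for every `a`,
then every prime dividing `[A : M]` divides `m` (an element of prime order `ℓ` of `A/M` is killed by
`m`). [folklore] -/
theorem prime_dvd_of_dvd_index_of_forall_nsmul_mem (M : AddSubgroup A) (hM : M.index ≠ 0) {m : ℕ}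
    (hm : ∀ a : A, m • a ∈ M) {ℓ : ℕ} (hℓ : ℓ.Prime) (hdvd : ℓ ∣ M.index) : ℓ ∣ m := by
  haveI : Fact ℓ.Prime := ⟨hℓ⟩
  letI : Fintype (A ⧸ M) := AddSubgroup.fintypeOfIndexNeZero hM
  have hcard : ℓ ∣ Fintype.card (A ⧸ M) := by
    rwa [← Nat.card_eq_fintype_card, ← AddSubgroup.index_eq_card]
  obtain ⟨x, hx⟩ := exists_prime_addOrderOf_dvd_card ℓ hcard
  obtain ⟨a, rfl⟩ := QuotientAddGroup.mk_surjective x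
  have h0 : m • (QuotientAddGroup.mk a : A ⧸ M) = 0 := by
    rw [← QuotientAddGroup.mk_nsmul, QuotientAddGroup.eq_zero_iff]
    exact hm a
  rw [← hx]
  exact addOrderOf_dvd_of_nsmul_eq_zero h0

/-- **`[A : H + p^k·A] = p^{ord_p [A : H]}` when `ord_p [A : H] ≤ k`** (`H` of finite index): the
quotient `A/(H + p^k A)` is killed by `p^k`, so its order is a power of `p`; the intermediate quotient
`(H + p^k A)/H` is killed by the prime-to-`p` part of `[A : H]`, so its order is prime to `p`; and
`[A : H] = [A : H + p^k A] · [H + p^k A : H]`. No cyclicity of `A/H` is needed. [folklore] -/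
theorem index_sup_range_zsmul_pow_eq (H : AddSubgroup A) (hH : H.index ≠ 0) {p : ℕ} (hp : p.Prime)
    {k : ℕ} (hk : (H.index).factorization p ≤ k) :
    (H ⊔ (zsmulAddGroupHom ((p ^ k : ℕ) : ℤ) : A →+ A).range).index = p ^ (H.index).factorization p := by
  set c := H.index with hc
  set t := c.factorization p with ht
  set M := H ⊔ (zsmulAddGroupHom ((p ^ k : ℕ) : ℤ) : A →+ A).range with hM
  have hHM : H ≤ M := le_sup_left
  have hMdvd : M.index ∣ c := AddSubgroup.index_dvd_of_le hHM
  have hM0 : M.index ≠ 0 := fun h ↦ hH (Nat.eq_zero_of_zero_dvd (h ▸ hMdvd))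
  -- (1) `A/M` is killed by `p^k`: `[A : M]` is a power of `p`
  have hkill : ∀ a : A, (p ^ k) • a ∈ M := fun a ↦ by
    refine AddSubgroup.mem_sup_right ⟨a, ?_⟩
    rw [zsmulAddGroupHom_apply, natCast_zsmul]
  have hMpow : M.index = p ^ (M.index).primeFactorsList.length :=
    Nat.eq_prime_pow_of_unique_prime_dvd hM0 fun hd hdvd ↦
      (Nat.prime_dvd_prime_iff_eq hd hp).mp (hd.dvd_of_dvd_pow
        (prime_dvd_of_dvd_index_of_forall_nsmul_mem M hM0 hkill hd hdvd))
  set s := (M.index).primeFactorsList.length with hs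
  -- (2) `M/H` is killed by `c' = c / p^t`: `[M : H]` is prime to `p`
  have hsplit : p ^ t * (c / p ^ t) = c := Nat.ordProj_mul_ordCompl_eq_self c p
  have hcop : Nat.Coprime p (c / p ^ t) := Nat.coprime_ordCompl hp hH
  have hkill' : ∀ x : M, (c / p ^ t) • x ∈ H.addSubgroupOf M := by
    rintro ⟨x, hx⟩
    rw [AddSubgroup.mem_addSubgroupOf]
    change (c / p ^ t) • x ∈ H
    obtain ⟨h, hh, z, ⟨a, rfl⟩, rfl⟩ := AddSubgroup.mem_sup.mp hx
    rw [smul_add, zsmulAddGroupHom_apply, natCast_zsmul, ← mul_nsmul']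
    refine H.add_mem (H.nsmul_mem hh _) ?_
    have hexp : c / p ^ t * p ^ k = p ^ (k - t) * c := by
      obtain ⟨r, hr⟩ := Nat.exists_eq_add_of_le hk
      rw [hr, Nat.add_sub_cancel_left, pow_add,
        show c / p ^ t * (p ^ t * p ^ r) = (p ^ t * (c / p ^ t)) * p ^ r by ring, hsplit, mul_comm]
    rw [hexp, mul_nsmul']
    exact H.nsmul_mem (AddSubgroup.nsmul_index_mem H a) _
  have hrel0 : H.relIndex M ≠ 0 := by
    intro h0
    have := AddSubgroup.relIndex_mul_index hHM
    rw [h0, zero_mul] at this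
    exact hH this.symm
  have hnotp : ¬ p ∣ H.relIndex M := fun hpd ↦ by
    have h := prime_dvd_of_dvd_index_of_forall_nsmul_mem (H.addSubgroupOf M)
      (by rwa [← AddSubgroup.relIndex] ) hkill' hp (by rwa [← AddSubgroup.relIndex])
    exact (Nat.coprime_iff_gcd_eq_one.mp hcop ▸ Nat.dvd_gcd (dvd_refl p) h |> fun h1 ↦
      hp.one_lt.ne' (Nat.dvd_one.mp h1))
  -- (3) `c = [M : H]·[A : M]` and compare `p`-parts
  have hprod : H.relIndex M * M.index = c := AddSubgroup.relIndex_mul_index hHM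
  have hfac : c.factorization p = s := by
    rw [← hprod, Nat.factorization_mul hrel0 hM0, Finsupp.add_apply,
      Nat.factorization_eq_zero_of_not_dvd hnotp, zero_add, hMpow, Nat.Prime.factorization_pow hp,
      Finsupp.single_eq_same]
  rw [hMpow, ht, hfac]

end GroupTheory

/-! ## §2 (δ): the local index of the connected Kummer condition at level `p^k`, `k ≥ ord_p c_v` -/

section Local

universe u

variable {K : Type u} [Field K] [CharZero K] (W : WeierstrassCurve K) [W.IsElliptic]
  (E : Type u) [Field E] [CharZero E] [Algebra K E]
  (R : Type*) [CommRing R] [IsDomain R] [IsDiscreteValuationRing R] [Algebra R E]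
  [IsFractionRing R E] [(W.baseChange E).IsMinimal R]

/-- **Jetchev's (δ) / Lemma 3.2, index form, general case**: at a place with local Tamagawa number
`c_v = [(W⁄E)(E) : E₀(E)]` (finite, `hc0`) and a level `p^k` with `k ≥ ord_p c_v`,
`[𝓛_E : H¹_{Kum⁰}(E, W[p^k])] = p^{ord_p c_v}` (x11b3's `relIndex_connectedKummerCondition` + §1; the
printed `≅ ℤ/p^{m_v}` additionally asserts cyclicity, not needed for the count).
[cite: Jetchev2008, Lemma 3.2 (p. 814), (δ) (p. 822)] [cite: SilvermanAEC2009, VII.6] -/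
theorem relIndex_connectedKummerCondition_eq_pow {p : ℕ} (hp : p.Prime) (k : ℕ)
    (hn : ((p ^ k : ℕ) : ℤ) ≠ 0) (hc0 : (W.baseChange E).localTamagawaNumber R ≠ 0)
    (hk : ((W.baseChange E).localTamagawaNumber R).factorization p ≤ k) :
    (JetchevKummer.connectedKummerCondition W E R hn).relIndex
        (W.kummerLocalConditionAt ((p ^ k : ℕ) : ℤ) E) =
      p ^ ((W.baseChange E).localTamagawaNumber R).factorization p := by
  rw [JetchevKummer.relIndex_connectedKummerCondition W E R hn]
  rw [WeierstrassCurve.localTamagawaNumber_eq_index_goodReductionSubgroup R (W.baseChange E)] at hc0 hk ⊢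
  exact index_sup_range_zsmul_pow_eq _ hc0 hp hk

end Local

/-! ## §3 The stringent family of the road-K assembly at a minimal place -/

section Stringent

variable (W : WeierstrassCurve ℚ) [W.IsElliptic] (K : Type) [Field K] [NumberField K]

/-- **(δ) for the road-K stringent family `JET.stringentFamily`** at a finite place `q` of `K` where the
base change of `W` is minimal over `𝓞_{K_q}` (e.g. `W/ℚ` globally minimal and `q` over the carrier prime,
`K_q = ℚ_q`): `[H¹_Kum(K_q, E[p^k]) : 𝒮_q] = p^{ord_p c_q}` for `k ≥ ord_p c_q`, `c_q` the local Tamagawa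
number of `E/K_q` — the count behind `Nat.card Qg' = p^t` in the `hdual_q` package of
`JET.tamagawaExponent_le_mInfty_of_kernelInputs` (before the `−e`-part / swap of the two places over
the carrier is taken). [cite: Jetchev2008, Lemma 3.2 (p. 814), (δ) (p. 822)] -/
theorem relIndex_stringentFamily_eq_pow {p : ℕ} (hp : p.Prime) (k : ℕ)
    (hn : ((p ^ k : ℕ) : ℤ) ≠ 0) (q : HeightOneSpectrum (𝓞 K))
    [hmin : ((W.baseChange K).baseChange (q.adicCompletion K)).IsMinimal (q.adicCompletionIntegers K)]
    (hc0 : ((W.baseChange K).baseChange (q.adicCompletion K)).localTamagawaNumber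
      (q.adicCompletionIntegers K) ≠ 0)
    (hk : (((W.baseChange K).baseChange (q.adicCompletion K)).localTamagawaNumber
      (q.adicCompletionIntegers K)).factorization p ≤ k) :
    (stringentFamily W K hn (Sum.inr q)).relIndex
        ((W.baseChange K).kummerSelmerStructure ((p ^ k : ℕ) : ℤ) (Sum.inr q)) =
      p ^ (((W.baseChange K).baseChange (q.adicCompletion K)).localTamagawaNumber
        (q.adicCompletionIntegers K)).factorization p := by
  haveI : CharZero (q.adicCompletion K) :=
    charZero_of_injective_algebraMap (algebraMap K _).injective
  rw [stringentFamily_inr_of_isMinimal W K hn q, WeierstrassCurve.kummerSelmerStructure_apply]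
  exact relIndex_connectedKummerCondition_eq_pow (W.baseChange K) (q.adicCompletion K)
    (q.adicCompletionIntegers K) hp k hn hc0 hk

end Stringent

/-! ## §4 Cyclicity of the local quotient from the cyclicity of the component group (appended) -/

section Cyclic

variable {A : Type*} [AddCommGroup A]

/-- **`A/(H + n·A)` is cyclic if `A/H` is** (a quotient of a cyclic group): with `A = E(K_v)`,
`H = E₀(K_v)`, `n = p^k` this gives the cyclicity half of Jetchev's (δ) — `H¹_Kum/H¹_{Kum⁰} ≅
E(K_v)/(E₀ + p^k E(K_v))` is cyclic whenever the component group `E(K_v)/E₀(K_v)` is (split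
multiplicative reduction: the tree's
`isAddCyclic_quotient_goodReductionSubgroup_of_hasSplitMultiplicativeReduction`; Kodaira IV/IV* at
`p = 3`: order `3`). [cite: Jetchev2008, Lemma 3.2 (p. 814), (δ) (p. 822)] [folklore] -/
theorem isAddCyclic_quotient_sup_range_zsmul (H : AddSubgroup A) (n : ℤ) [hc : IsAddCyclic (A ⧸ H)] :
    IsAddCyclic (A ⧸ (H ⊔ (zsmulAddGroupHom n : A →+ A).range)) := by
  refine isAddCyclic_of_surjective
    (QuotientAddGroup.map H (H ⊔ (zsmulAddGroupHom n : A →+ A).range) (AddMonoidHom.id A)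
      (fun x hx ↦ AddSubgroup.mem_sup_left hx)) fun y ↦ ?_
  obtain ⟨a, rfl⟩ := QuotientAddGroup.mk_surjective y
  exact ⟨QuotientAddGroup.mk a, rfl⟩

/-- The same with the component group hypothesis stated on `E₀ = goodReductionSubgroup`: if
`(W⁄E)(E)/E₀(E)` is cyclic then `(W⁄E)(E)/(E₀(E) + n·(W⁄E)(E))` is cyclic — the group whose order
`relIndex_connectedKummerCondition_eq_pow` computes (via `JetchevKummer.relIndex_connectedKummerCondition`).
[cite: Jetchev2008, Lemma 3.2 (p. 814)] -/
theorem isAddCyclic_quotient_goodReductionSubgroup_sup_range {F : Type*} [Field F]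
    (X : WeierstrassCurve F) (R : Type*) [CommRing R] [IsDomain R] [IsDiscreteValuationRing R]
    [Algebra R F] [IsFractionRing R F] [X.IsMinimal R] (n : ℤ)
    [IsAddCyclic (X.toAffine.Point ⧸ X.goodReductionSubgroup R)] :
    IsAddCyclic (X.toAffine.Point ⧸
      (X.goodReductionSubgroup R ⊔ (zsmulAddGroupHom n : X.toAffine.Point →+ _).range)) :=
  isAddCyclic_quotient_sup_range_zsmul _ n

end Cyclic

end Summit.BirchSwinnertonDyer.Rank1Residual.JET

end
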